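import Mathlib
import Literature.NumberTheory.LFunctions.Zhang2022.SkeletonEvalRelEEdges
import Literature.NumberTheory.LFunctions.Zhang2022.Section2MainOrder
import Literature.NumberTheory.LFunctions.Zhang2022.SkeletonMainOrderNodes
import Literature.NumberTheory.LFunctions.Zhang2022.SkeletonC232E
import HarnessLib

/-!
# Zhang (2022), typed skeleton — the §2 endgame AT MAIN ORDER (terminal hypothesis E-105, RT-08)

Topic `Literature/NumberTheory/LFunctions/Zhang2022` (Landau–Siegel audit tree; verdict-neutral).
Y. Zhang, *Discrete mean estimates and the Landau–Siegel zero*, arXiv:2211.02515v1 (2022)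
[Zhang2022LandauSiegel] — **an unrefereed manuscript under adjudication. Nothing in this file asserts
any claim of the manuscript; every theorem is an implication (the two §2-level node readings with an
explicit constant, `Ineq232With` / `Ineq233With`, live in the statement file `SkeletonMainOrderNodes`).**

The §2 p. 6 endgame of the manuscript ("a contradiction is immediately derived from (2.18),
Propositions 2.4, 2.5 and 2.6", with Prop. 2.5 ⇐ (2.32) `Ξ₁ < 0.001𝔞𝔓` and (2.33) `Ξ_J < 3000𝔞𝔓`)
is re-run with the MAIN-ORDER CONSTANTS AS PARAMETERS instead of the printed numbers `5`, `0.001`,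
`3000`: if eventually under (A)

* `|Ξ₁*| ≥ (|𝔡′+𝔡| − η)𝔞𝔓` for every `η > 0` — from (10.17) `Eval1017`;
* `Ξ₁ ≤ (q + η)𝔞𝔓` for every `η > 0` — `Ineq232With c′ q`; from (8.23), (9.7) read with `𝔠₂ := k` and
  (18.1)ᴿ at a value `e1pp` of `e″_{1j}` one gets it with `q = 𝔠₁ + k + 2(Re 𝔠₃ + 10⁻⁵)`,
  `𝔠₃ := frakc3E e1pp` (`ineq232With_of_evals`, NO margin hypothesis);
* `Ξ_J ≤ (c_J + η)𝔞𝔓` for every `η > 0` — `Ineq233With c′ c_J`; from the typed (18.3) bound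
  `Bound183` one gets it with `c_J = 8800/π` (`ineq233With_of_bound183`); a sharper (18.3) gives `C233`;
* `Ξ₃* ≤ ε𝔞𝔓` for every `ε > 0` — Prop. 2.6 (from (11.1) and (9.7), `prop26_of_evals_with`),

then (2.18) forces `|𝔡′+𝔡| ≤ √(q·c_J)` (the tree's generic `EndgameData.false_of_closing`,
`Section2Assembly`), so the argument closes EXACTLY under the LS programme's §18 estimate of record
**E-105** `MainOrderContradiction q c_J := √(q·c_J) < |𝔡′+𝔡|` (`Section2MainOrder`), which is an
open condition and therefore absorbs all the `o(𝔞𝔓)`'s (`exists_closing_margin`). Main results: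

* `eventually_not_assumptionA_mainOrder` / `theorem1_of_mainOrder` — Theorem 1 ⇐ Prop 2.2 (i), Lemma 2.3,
  (10.17), `Ineq232With c′ q`, `Ineq233With c′ c_J`, Prop 2.6 and `MainOrderContradiction q c_J`;
* `theorem1_of_evaluations_mainOrder` — the same from the evaluations the whole-DAG skeleton produces
  ((8.23), (9.7)@k, (18.1)ᴿ@e1pp, (18.3), (11.1)) with
  `h18 : MainOrderContradiction (c232E e1pp k) c_J`, `c232E e1pp k := 𝔠₁ + k + 2(Re 𝔠₃ + 10⁻⁵)` (R-35c decl
  of record, `SkeletonC232E`), `c_J = 8800/π` today (R-35d) — the shape of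
  the ZHANG-L lane's terminal `theorem1_of_sec18E` (zl-lead R-35 / RT-08; director-frontier 00:12Z;
  ls-theory's naming of E-105). HONESTY (R-07/RT-08): `h18` is consumed POSITIVELY (it is the strict
  inequality that picks the closing margin); at the constants the tree instantiates it is REFUTED
  (`Section2MainOrder.not_mainOrderContradiction`, certified `√(C₂₃₂C₂₃₃) > 12.68 > |𝔡′+𝔡|`), so any
  theorem with this hypothesis is DOCUMENTARY; none of those refutations is used here.

What is NOT asserted: any evaluation; `MainOrderContradiction` at any constants; Theorem 1; anything
about Landau–Siegel zeros.

## References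

* Y. Zhang, arXiv:2211.02515v1 (2022), §2 p. 6 ((2.18), Props. 2.4–2.6, (2.32)–(2.33)), §18 p. 99–100.
  [cite: Zhang2022LandauSiegel, §2 p. 6]
-/

noncomputable section

open Complex Real Filter Topology

namespace Literature.NumberTheory.LFunctions.Zhang2022.Skeleton



/-! ## The closing margin: `MainOrderContradiction` is an open condition -/

/-- If `√(q·c_J) < d` then for some `η > 0` still `√((q+η)(c_J+η)) + 2η < d` (continuity at `η = 0`) —
the room that absorbs the `o(𝔞𝔓)` of Props. 2.4–2.6 in the final step of §2 p. 6.
[cite: Zhang2022LandauSiegel, §2 p. 6] -/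
theorem exists_closing_margin {q cJ d : ℝ} (h : Real.sqrt (q * cJ) < d) :
    ∃ η : ℝ, 0 < η ∧ Real.sqrt ((q + η) * (cJ + η)) + 2 * η < d := by
  have hcont : ContinuousAt (fun η : ℝ => Real.sqrt ((q + η) * (cJ + η)) + 2 * η) 0 := by
    fun_prop
  have h0 : (fun η : ℝ => Real.sqrt ((q + η) * (cJ + η)) + 2 * η) 0 < d := by simpa using h
  have hev : ∀ᶠ η in 𝓝 (0 : ℝ), Real.sqrt ((q + η) * (cJ + η)) + 2 * η < d :=
    hcont.eventually (gt_mem_nhds h0)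
  obtain ⟨ε, hε, hball⟩ := Metric.eventually_nhds_iff.mp hev
  refine ⟨ε / 2, by positivity, hball ?_⟩
  rw [Real.dist_eq, sub_zero, abs_of_pos (by positivity)]
  linarith

/-! ## The contradiction at main order -/

/-- **§2 p. 6 at main order**: Prop 2.2 (i), Lemma 2.3, (10.17), (2.32)@`q`, (2.33)@`c_J`, Prop 2.6 and
`√(q·c_J) < |𝔡′+𝔡|` imply that (A) fails for every real primitive character to every sufficiently large
modulus — (2.18) `|Ξ₁*| ≤ Ξ₂* + Ξ₃*`, Cauchy `Ξ₂* ≤ √(Ξ₁Ξ_J)` (the tree's `EndgameData`), and the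
closing margin of `exists_closing_margin`. The hypothesis `hM` is used POSITIVELY.
[cite: Zhang2022LandauSiegel, §2 p. 6] -/
theorem eventually_not_assumptionA_mainOrder {c' q cJ : ℝ} (h22 : Prop22i) (h23 : Lemma23 c')
    (hprim : PsiChiPrimitive) (h1017 : Eval1017 c') (h232 : Ineq232With c' q)
    (h233 : Ineq233With c' cJ) (h26 : Prop26 c') (hM : MainOrderContradiction q cJ)
    (ha : FrakALowerBound) :
    ∃ D₀ : ℕ, ∀ (D : ℕ) [NeZero D] (χ : DirichletCharacter ℂ D),
      D₀ ≤ D → χ.IsQuadratic → χ.IsPrimitive → ¬ AssumptionA D χ := by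
  unfold MainOrderContradiction at hM
  set d : ℝ := ‖dprime + dfrak‖ with hd
  obtain ⟨η, hη, hclose⟩ := exists_closing_margin hM
  obtain ⟨a₀, ha₀, ha⟩ := ha
  obtain ⟨D₁, hP⟩ := frakP_eventually_pos
  have hηa : 0 < η * a₀ := mul_pos hη ha₀
  obtain ⟨D₀, h⟩ := (((((h22.and h23).and (h1017 _ hηa)).and (h232 η hη)).and (h233 η hη)).and
    (h26 η hη)).and ha
  refine ⟨max (max D₀ D₁) 3, fun D _ χ hD hq hp hA => ?_⟩
  have hD3 : 3 ≤ D := le_trans (le_max_right _ _) hD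
  have hD₀ : D₀ ≤ D := le_trans (le_trans (le_max_left _ _) (le_max_left _ _)) hD
  have hD₁ : D₁ ≤ D := le_trans (le_trans (le_max_right _ _) (le_max_left _ _)) hD
  obtain ⟨⟨⟨⟨⟨⟨h22', h23'⟩, h1017'⟩, h232'⟩, h233'⟩, h26'⟩, ha'⟩ := h D χ hD₀ hq hp
  have hPpos : 0 < frakP D := hP D hD₁
  have haa : a₀ ≤ frakA χ := ha' hA
  have hApos : 0 < frakA χ := lt_of_lt_of_le ha₀ haa
  set aP : ℝ := frakA χ * frakP D with haP_def
  have haP : 0 < aP := mul_pos hApos hPpos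
  -- Prop 2.4 at main order: `|Ξ₁*| ≥ (d − η)𝔞𝔓`
  have h24 : (d - η) * aP ≤ ‖xiStar1 c' χ‖ := by
    have e := h1017' hA
    have hmain : ‖(dprime + dfrak) * (frakA χ : ℂ) * (frakP D : ℂ)‖ = d * aP := by
      rw [norm_mul, norm_mul, Complex.norm_of_nonneg hApos.le, Complex.norm_of_nonneg hPpos.le,
        hd, haP_def, mul_assoc]
    have tri : ‖(dprime + dfrak) * (frakA χ : ℂ) * (frakP D : ℂ)‖ - ‖xiStar1 c' χ‖ ≤
        ‖xiStar1 c' χ - (dprime + dfrak) * frakA χ * frakP D‖ := by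
      have t := norm_sub_norm_le ((dprime + dfrak) * (frakA χ : ℂ) * (frakP D : ℂ)) (xiStar1 c' χ)
      rwa [norm_sub_rev] at t
    have hεη : η * a₀ * frakP D ≤ η * aP := by
      rw [haP_def, ← mul_assoc]
      exact mul_le_mul_of_nonneg_right (mul_le_mul_of_nonneg_left haa hη.le) hPpos.le
    nlinarith [tri, e, hmain, hεη]
  have h232'' : xi1 c' χ ≤ (q + η) * aP := by rw [haP_def, ← mul_assoc]; exact h232' hA
  have h233'' : xiJ c' χ ≤ (cJ + η) * aP := by rw [haP_def, ← mul_assoc]; exact h233' hA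
  have h26'' : xiStar3 c' χ ≤ η * aP := by rw [haP_def, ← mul_assoc]; exact h26' hA
  -- package the §2 datum and close with the tree's generic (2.18)+Cauchy lemma
  obtain ⟨hc, hω, hZ⟩ := pointwise_inputs c' χ hD3 h23' h22' (fun x => hprim D χ x hD3 hp)
  let E := endgame c' χ (fun i hi => (hc i hi).2) (fun i hi => (hω i hi).1) hZ
  have hx1 : E.xiStar1 = xiStar1 c' χ :=
    endgame_xiStar1 (fun i hi => (hc i hi).1) (fun i hi => (hω i hi).2)
  have hxi1 : E.xi1 = xi1 c' χ := endgame_xi1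
  have hxiJ : E.xiJ = xiJ c' χ := endgame_xiJ
  have hx3 : E.xiStar3 = xiStar3 c' χ := endgame_xiStar3
  refine E.false_of_closing (d := d - η) (q := q + η) (cJ := cJ + η) (ε := η) haP
    (by linarith) ?_ ?_ ?_ ?_
  · rw [hx1]; exact h24
  · rw [hxi1]; exact h232''
  · rw [hxiJ]; exact h233''
  · rw [hx3]; exact h26''

/-- **Theorem 1 at main order**: Prop 2.2 (i), Lemma 2.3, (10.17), (2.32)@`q`, (2.33)@`c_J`, Prop 2.6
and the §18 estimate of record `MainOrderContradiction q c_J` (E-105) give `L(1,χ) > c(log D)⁻²⁰²²`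
(`theorem1_of_eventually_not_assumptionA`; `PsiChiPrimitive`, `FrakALowerBound` discharged in tree).
[cite: Zhang2022LandauSiegel, §2 p. 6] -/
theorem theorem1_of_mainOrder {c' q cJ : ℝ} (h22 : Prop22i) (h23 : Lemma23 c')
    (h1017 : Eval1017 c') (h232 : Ineq232With c' q) (h233 : Ineq233With c' cJ) (h26 : Prop26 c')
    (hM : MainOrderContradiction q cJ) : Theorem1 :=
  theorem1_of_eventually_not_assumptionA
    (eventually_not_assumptionA_mainOrder h22 h23 psiChiPrimitive_holds h1017 h232 h233 h26 hM
      frakALowerBound_holds)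

/-! ## The two main-order inputs from the evaluations — NO margin hypothesis -/

/-- **(2.32) at main order from (8.23), (9.7) [`𝔠₂ := k`] and (18.1)ᴿ [𝔠₃ := `frakc3E e1pp`]**
(§18 p. 99–100): `Ξ₁ = Ξ₁₁ + Ξ₁₂ + 2Re Ξ₁₃ ≤ (𝔠₁ + k + 2(Re 𝔠₃ + 10⁻⁵) + η)𝔞𝔓` eventually, for every
`η > 0` — the arithmetic of `ineq232_of_evals_with` WITHOUT the margin (the `o((𝔞+1)𝔓)` errors are
absorbed through `𝔞 ≥ a₀`, `ε = ηa₀/(8 + 4a₀)`). UNCONDITIONAL in the margin; this is the honest content of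
§18's "(8.23), (9.7) and (18.1) yield (2.32)". [cite: Zhang2022LandauSiegel, §18 p. 100] -/
theorem ineq232With_of_evals {e1pp : ℕ → ℂ} {c' k : ℝ} (h22 : Prop22i) (h23 : Lemma23 c')
    (hprim : PsiChiPrimitive) (h823 : Eval823 c') (h97 : Eval97With c' k)
    (h181 : Eval181RelE e1pp c') (ha : FrakALowerBound) :
    Ineq232With c' (frakc1.re + k + 2 * ((frakc3E e1pp).re + 1e-5)) := by
  intro η hη
  obtain ⟨a₀, ha₀, ha⟩ := ha
  obtain ⟨D₁, hP⟩ := frakP_eventually_pos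
  set ε : ℝ := η * a₀ / (8 + 4 * a₀) with hε
  have hε0 : 0 < ε := by positivity
  have hεid : ε * (8 + 4 * a₀) = η * a₀ := by rw [hε]; field_simp
  obtain ⟨D₀, h⟩ := ((((h22.and h23).and (h823 ε hε0)).and (h97 ε hε0)).and (h181 ε hε0)).and ha
  refine ⟨max (max D₀ D₁) 3, fun D _ χ hD hq hp hA => ?_⟩
  have hD3 : 3 ≤ D := le_trans (le_max_right _ _) hD
  have hD₀ : D₀ ≤ D := le_trans (le_trans (le_max_left _ _) (le_max_left _ _)) hD
  have hD₁ : D₁ ≤ D := le_trans (le_trans (le_max_right _ _) (le_max_left _ _)) hD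
  obtain ⟨⟨⟨⟨⟨h22', h23'⟩, h823'⟩, h97'⟩, h181'⟩, ha'⟩ := h D χ hD₀ hq hp
  have hPpos : 0 < frakP D := hP D hD₁
  have haa : a₀ ≤ frakA χ := ha' hA
  have e1 := abs_le.mp (h823' hA)
  have e2 := abs_le.mp (h97' hA)
  have e3 : |(xi13 c' χ).re - (frakc3E e1pp).re * frakA χ * frakP D| ≤
      1e-5 * frakA χ * frakP D + ε * (frakA χ + 1) * frakP D := by
    have h3 := h181' hA
    have : (xi13 c' χ - frakc3E e1pp * frakA χ * frakP D).re =
        (xi13 c' χ).re - (frakc3E e1pp).re * frakA χ * frakP D := by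
      simp [Complex.sub_re, Complex.mul_re]
    rw [← this]
    exact le_trans (Complex.abs_re_le_norm _) h3
  have e3' := abs_le.mp e3
  rw [xi1_eq_of χ hD3 h23' h22' (fun x => hprim D χ x hD3 hp)]
  have hA0 : 0 < frakA χ := lt_of_lt_of_le ha₀ haa
  -- `ε(4 + 2𝔞)𝔓 < η𝔞𝔓`
  have h4 : ε * (4 + 2 * frakA χ) * frakP D < η * frakA χ * frakP D := by
    have hlt : ε * (4 + 2 * frakA χ) < η * frakA χ := by
      have h8 : (0 : ℝ) < 8 + 4 * a₀ := by positivity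
      have key : ε * (4 + 2 * frakA χ) * (8 + 4 * a₀) < η * frakA χ * (8 + 4 * a₀) := by
        calc ε * (4 + 2 * frakA χ) * (8 + 4 * a₀) = η * a₀ * (4 + 2 * frakA χ) := by
              rw [mul_assoc, mul_comm (4 + 2 * frakA χ), ← mul_assoc, hεid]
          _ = η * (4 * a₀ + 2 * a₀ * frakA χ) := by ring
          _ < η * (8 * frakA χ + 4 * a₀ * frakA χ) := by
              refine mul_lt_mul_of_pos_left ?_ hη
              nlinarith
          _ = η * frakA χ * (8 + 4 * a₀) := by ring
      exact lt_of_mul_lt_mul_right key h8.le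
    exact mul_lt_mul_of_pos_right hlt hPpos
  nlinarith [e1.2, e2.2, e3'.2, h4]

/-- The same with the constant BY NAME: `Ineq232With c′ (c232E e1pp k)` (`c232E` unfolds to the
expression above). [cite: Zhang2022LandauSiegel, §18 p. 100] -/
theorem ineq232With_of_evals_c232E {e1pp : ℕ → ℂ} {c' k : ℝ} (h22 : Prop22i) (h23 : Lemma23 c')
    (hprim : PsiChiPrimitive) (h823 : Eval823 c') (h97 : Eval97With c' k)
    (h181 : Eval181RelE e1pp c') (ha : FrakALowerBound) : Ineq232With c' (c232E e1pp k) :=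
  ineq232With_of_evals h22 h23 hprim h823 h97 h181 ha

/-- **(2.33) at main order from a (18.3)-type bound with constant `c_J`** (`Ξ_J ≤ c_J𝔞𝔓 + ε𝔓` for every
`ε > 0`, eventually — the shape of the typed `Bound183` at `c_J = 8800/π` and of any sharper parametric
twin `Bound183With c′ c_J`): `Ξ_J ≤ (c_J + η)𝔞𝔓` eventually, every `η > 0` (`ε := ηa₀`, `𝔞 ≥ a₀`).
[cite: Zhang2022LandauSiegel, §18 pp. 100–101, (18.3)] -/
theorem ineq233With_of_bound {c' cJ : ℝ}
    (h183 : ∀ ε : ℝ, 0 < ε → ForAllLarge fun D _ χ => AssumptionA D χ →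
      xiJ c' χ ≤ cJ * frakA χ * frakP D + ε * frakP D)
    (ha : FrakALowerBound) : Ineq233With c' cJ := by
  intro η hη
  obtain ⟨a₀, ha₀, ha⟩ := ha
  obtain ⟨D₀, h⟩ := (h183 (η * a₀) (mul_pos hη ha₀)).and ha
  refine ⟨D₀, fun D _ χ hD hq hp hA => ?_⟩
  obtain ⟨h183', ha'⟩ := h D χ hD hq hp
  have haa : a₀ ≤ frakA χ := ha' hA
  have hP0 : 0 ≤ frakP D := frakP_nonneg D
  have hb := h183' hA
  have : η * a₀ * frakP D ≤ η * frakA χ * frakP D :=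
    mul_le_mul_of_nonneg_right (mul_le_mul_of_nonneg_left haa hη.le) hP0
  nlinarith [hb, this]

/-- **(2.33) at main order from the typed (18.3) bound** `Bound183` (`Ξ_J ≤ (8800/π)𝔞𝔓 + ε𝔓`):
`Ξ_J ≤ (8800/π + η)𝔞𝔓` eventually, every `η > 0`. [cite: Zhang2022LandauSiegel, §18 pp. 100–101, (18.3)] -/
theorem ineq233With_of_bound183 {c' : ℝ} (h183 : Bound183 c') (ha : FrakALowerBound) :
    Ineq233With c' (8800 / π) :=
  ineq233With_of_bound h183 ha

/-! ## Theorem 1 from the evaluations and E-105 -/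

/-- **Theorem 1 from the skeleton's evaluations and the §18 estimate of record E-105**
(`MainOrderContradiction`, Section2MainOrder:65, named by ls-theory 2026-08-27; ZHANG-L RT-08):
Prop 2.2 (i), Lemma 2.3, (10.17), (8.23), (9.7) read with `𝔠₂ := k`, (18.1)ᴿ at a value `e1pp` of
`e″_{1j}`, a (2.33)-shape bound `Ξ_J ≤ (c_J + η)𝔞𝔓` and (11.1) imply Theorem 1 PROVIDED
`√(q·c_J) < |𝔡′+𝔡|` with `q = 𝔠₁ + k + 2(Re 𝔠₃ + 10⁻⁵)`, `𝔠₃ = frakc3E e1pp`. The hypothesis `h18` is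
consumed positively; at the constants the tree instantiates (`k = frakc2c.re`, `e1pp = e1ppD` or
`e1ppj`, `c_J = 8800/π` or `C233`) it is REFUTED (`Section2MainOrder.not_mainOrderContradiction` and the
lane's certified twins), so such instances are DOCUMENTARY. [cite: Zhang2022LandauSiegel, §2 p. 6, §18] -/
theorem theorem1_of_evaluations_mainOrder {e1pp : ℕ → ℂ} {c' k cJ : ℝ} (h22 : Prop22i)
    (h23 : Lemma23 c') (h1017 : Eval1017 c') (h823 : Eval823 c') (h97 : Eval97With c' k)
    (h181 : Eval181RelE e1pp c') (h233 : Ineq233With c' cJ)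
    (h18 : MainOrderContradiction (c232E e1pp k) cJ) (h111 : Eval111 c') : Theorem1 :=
  have ha : FrakALowerBound := frakALowerBound_holds
  have hprim : PsiChiPrimitive := psiChiPrimitive_holds
  theorem1_of_mainOrder h22 h23 h1017 (ineq232With_of_evals_c232E h22 h23 hprim h823 h97 h181 ha) h233
    (prop26_of_evals_with h22 h23 hprim h111 h97 ha) h18

/-- The same with the (2.33)-input the typed skeleton produces today, `Bound183 c′` (constant `8800/π`).
[cite: Zhang2022LandauSiegel, §2 p. 6, §18 (18.3)] -/
theorem theorem1_of_evaluations_mainOrder_bound183 {e1pp : ℕ → ℂ} {c' k : ℝ} (h22 : Prop22i)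
    (h23 : Lemma23 c') (h1017 : Eval1017 c') (h823 : Eval823 c') (h97 : Eval97With c' k)
    (h181 : Eval181RelE e1pp c') (h183 : Bound183 c')
    (h18 : MainOrderContradiction (c232E e1pp k) (8800 / π)) (h111 : Eval111 c') : Theorem1 :=
  theorem1_of_evaluations_mainOrder h22 h23 h1017 h823 h97 h181
    (ineq233With_of_bound183 h183 frakALowerBound_holds) h18 h111

end Literature.NumberTheory.LFunctions.Zhang2022.Skeleton
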